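import Literature.NumberTheory.EllipticCurves.ModularSymbolsRationalWeightTwo
import Literature.NumberTheory.EllipticCurves.ModularSymbolsOrdinaryMeasureValues
import HarnessLib

/-!
# The Mazur–Tate–Teitelbaum measure as the value of a measure-valued ordinary eigensymbol

For a normalised newform `f ∈ S₂(Γ₀(N))` with rational coefficients and `Ω⁺_f ≠ 0`, a prime
`p ∤ N` and a unit root `α ∈ ℤ_p^×` of `X² − a_p X + p`, the integral `p`-stabilised plus symbol
`Φ ∈ Symb_{Γ₀(Np)}(Sym⁰ ℤ_p)` of `ModularSymbolsRationalWeightTwo.exists_intStabSymb` lifts, by the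
slope-`0` control theorem with measure coefficients
(`ModularSymbolsOrdinaryMeasuresApprox.existsUnique_measureValued_eigensymbol_of_exact`, through the
total-mass morphism `massHom : 𝔻⁰_0 → Sym⁰ ℤ_p`), to a UNIQUE `U_p`-eigensymbol
`Ψ_f ∈ Symb_{Γ₀(Np)}(𝔻⁰_0)` with values in MEASURES on `ℤ_p`, `U_p Ψ_f = α Ψ_f`, and by the
Mazur–Tate–Teitelbaum value formula (`ModularSymbolsOrdinaryMeasureValues.integral_cellInd_mul_pow_zero_infty`)
**the measure `Ψ_f(0, ∞)` is `−p^m · μ_{f,α}`**, `μ_{f,α}` the Mazur–Swinnerton-Dyer /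
Mazur–Tate–Teitelbaum measure of the tree (`PAdicLFunction.msdMeasure`)
(`exists_measureValued_eigensymbol_msdMeasure`).  This is the weight-`2` instance of
Greenberg–Stevens 1993, Thm. 4.10 / (4.10): the `p`-adic `L`-function of `f` is the Mellin transform
of the value at `{0} − {∞}` of the ordinary measure-valued modular symbol attached to `f_α`.

Everything is proved; no named facts.

## References

* B. Mazur, J. Tate, J. Teitelbaum, Invent. Math. 84 (1986), §I.10–§I.11. [MazurTateTeitelbaum1986Invent]
* R. Greenberg, G. Stevens, Invent. Math. 111 (1993), §4, Thm. 4.10. [GreenbergStevens1993]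
-/

noncomputable section

open scoped MatrixGroups ModularForm
open Matrix CongruenceSubgroup

namespace Literature.NumberTheory.EllipticCurves

open ModularForms ModularForms.HidaCohomology

variable {p : ℕ} [Fact p.Prime]

/-! ### The total mass morphism `𝔻⁰_0 → Sym⁰ ℤ_p` -/

section Mass

/-- **The total mass is invariant under the weight-`0` action** of `Σ₀(N)`, `p ∣ N`. [folklore] -/
theorem moment_zero_distρInt_weightZero {N : ℕ} (hpN : p ∣ N) {M : Matrix (Fin 2) (Fin 2) ℤ} (hM : M ∈ sigma0Set N) (μ : DInt p) :
    moment (distρInt p 0 M μ).1 0 = moment μ.1 0 := by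
  have hent := norm_entries_of_mem_sigma0Set hpN hM
  rw [distρInt_val_eq_weightActD 0 hpN hM μ, moment_def, integralFn_weightActD 0 hent.1 hent.2 _ _ _ (uniformContinuous_coe_pow 0),
    moment_def]
  congr 1
  funext z
  rw [pow_zero, pow_zero, BoundedDistribution.autPow_apply, pow_zero, PadicInt.coe_one, map_one, mul_one]

/-- The total mass as an element of `ℤ_p`. [folklore] -/
def massInt (μ : DInt p) : ℤ_[p] := ⟨moment μ.1 0, norm_moment_le_one μ.2 0⟩

/-- Its value. [folklore] -/
@[simp] theorem coe_massInt (μ : DInt p) : (massInt μ : ℚ_[p]) = moment μ.1 0 := rfl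

variable (p) in
/-- **The total-mass morphism `𝔻⁰_0 → Sym⁰ ℤ_p`** of coefficient systems on `Σ₀(N)`, `p ∣ N` (the
specialisation `ρ_0`). [folklore] -/
def massHom (N : ℕ) (hpN : p ∣ N) : CoeffActionOn.Hom (distCoeffInt p 0 N hpN) (CoeffActionOn.symPowOn (sigma0Set N) 0 ℤ_[p]) where
  toLinearMap :=
    { toFun := fun μ _ => massInt μ
      map_add' := fun μ ν => by
        funext i
        apply Subtype.ext
        change moment (μ + ν).1 0 = moment μ.1 0 + moment ν.1 0
        exact moment_add μ.2.1 ν.2.1 0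
      map_smul' := fun c μ => by
        funext i
        apply Subtype.ext
        change moment (c • μ).1 0 = (c : ℚ_[p]) * moment μ.1 0
        exact moment_smul μ.2.1 c 0 }
  comm M hM μ := by
    funext i
    apply Subtype.ext
    change moment (distρInt p 0 M μ).1 0 = ((act 0 M fun _ => massInt μ) i : ℚ_[p])
    rw [act_zero_eq_id, LinearMap.id_apply, coe_massInt, moment_zero_distρInt_weightZero hpN hM]

/-- Values of `massHom`. [folklore] -/
@[simp] theorem massHom_apply {N : ℕ} (hpN : p ∣ N) (μ : DInt p) (i : Fin 1) : (massHom p N hpN).toLinearMap μ i = massInt μ := rfl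

/-- The kernel of `massHom` is the measures of total mass `0`. [folklore] -/
theorem massHom_ker {N : ℕ} (hpN : p ∣ N) (μ : DInt p) (h : (massHom p N hpN).toLinearMap μ = 0) : ∀ i ≤ 0, moment μ.1 i = 0 := by
  intro i hi
  obtain rfl : i = 0 := Nat.le_zero.mp hi
  have := congrArg (fun v : Fin 1 → ℤ_[p] => ((v 0 : ℤ_[p]) : ℚ_[p])) h
  simpa using this

/-- `F⁰ 𝔻⁰_0 ⊆ ker massHom`. [folklore] -/
theorem filGInt_le_ker_massHom {N : ℕ} (hpN : p ∣ N) : filGInt p 0 0 ≤ LinearMap.ker (massHom p N hpN).toLinearMap := by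
  intro μ hμ
  rw [LinearMap.mem_ker]
  funext i
  apply Subtype.ext
  change moment μ.1 0 = 0
  exact (mem_filG_iff.mp ((mem_filGInt_iff (p := p)).mp hμ)).2.1 0 le_rfl

/-! ### Dirac measures: `massHom` is surjective -/

/-- **The Dirac measure at `0`** (level data). [folklore] -/
def diracZero : (n : ℕ) → ZMod (p ^ n) → ℚ_[p] := fun _ a => if a = 0 then 1 else 0

/-- Unfolding `diracZero`. [folklore] -/
theorem diracZero_apply (n : ℕ) (a : ZMod (p ^ n)) : diracZero (p := p) n a = if a = 0 then 1 else 0 := rfl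

/-- The Dirac measure at `0` is a bounded distribution. [folklore] -/
theorem diracZero_mem_distributions : diracZero (p := p) ∈ (ProfiniteTower.padicInt p).distributions ℚ_[p] := by
  refine ProfiniteTower.mem_distributions_iff.mpr ⟨fun n (a : ZMod (p ^ n)) => ?_, 1, fun n (a : ZMod (p ^ n)) => ?_⟩
  · -- fibre sums
    change ∑ b ∈ Finset.univ.filter (fun b : ZMod (p ^ (n + 1)) => ZMod.castHom (pow_dvd_pow p n.le_succ) (ZMod (p ^ n)) b = a),
      diracZero (p := p) (n + 1) b = diracZero (p := p) n a
    simp only [diracZero_apply]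
    rw [Finset.sum_ite, Finset.sum_const_zero, add_zero, Finset.sum_const, nsmul_eq_mul, mul_one]
    by_cases ha : a = 0
    · rw [if_pos ha]
      have hcard : (Finset.filter (fun b : ZMod (p ^ (n + 1)) => b = 0)
          (Finset.univ.filter fun b : ZMod (p ^ (n + 1)) => ZMod.castHom (pow_dvd_pow p n.le_succ) (ZMod (p ^ n)) b = a)).card = 1 := by
        rw [Finset.card_eq_one]
        refine ⟨0, Finset.ext fun b => ?_⟩
        simp only [Finset.mem_filter, Finset.mem_univ, true_and, Finset.mem_singleton]
        constructor
        · exact fun h => h.2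
        · rintro rfl; exact ⟨by rw [map_zero, ha], rfl⟩
      rw [hcard, Nat.cast_one]
    · rw [if_neg ha]
      have hcard : (Finset.filter (fun b : ZMod (p ^ (n + 1)) => b = 0)
          (Finset.univ.filter fun b : ZMod (p ^ (n + 1)) => ZMod.castHom (pow_dvd_pow p n.le_succ) (ZMod (p ^ n)) b = a)).card = 0 := by
        rw [Finset.card_eq_zero, Finset.filter_eq_empty_iff]
        intro b hb hb0
        rw [Finset.mem_filter] at hb
        apply ha
        rw [← hb.2, hb0, map_zero]
      rw [hcard, Nat.cast_zero]
  · rw [diracZero_apply]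
    split_ifs <;> simp

/-- The Dirac measure at `0` is a `ℤ_p`-valued measure. [folklore] -/
theorem diracZero_mem : diracZero (p := p) ∈ (ProfiniteTower.padicInt p).distributionsInt p := by
  refine ((ProfiniteTower.padicInt p).mem_distributionsInt_iff (p := p)).mpr ⟨diracZero_mem_distributions, fun n (a : ZMod (p ^ n)) => ?_⟩
  rw [diracZero_apply]
  split_ifs <;> simp

/-- The Dirac measure at `0` as an element of `𝔻⁰`. [folklore] -/
def diracZeroInt : DInt p := ⟨diracZero, diracZero_mem⟩

/-- The level-`0` cell is everything. [folklore] -/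
theorem cellInd_levelZero (a : ZMod (p ^ 0)) (z : ℤ_[p]) : cellInd (𝕜 := ℚ_[p]) 0 a z = 1 := by
  haveI : Subsingleton (ZMod (p ^ 0)) := by rw [pow_zero]; infer_instance
  rw [cellInd_apply]
  exact if_pos (Subsingleton.elim _ _)

/-- The Dirac measure has total mass `1`. [folklore] -/
theorem moment_zero_diracZero : moment (diracZeroInt (p := p)).1 0 = 1 := by
  rw [moment_def]
  have h := (ProfiniteTower.toBounded (diracZero_mem_distributions (p := p))).integral_cellInd (𝕜 := ℚ_[p]) 0 (0 : ZMod (p ^ 0))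
  rw [BoundedDistribution.integral_eq_integralFn, ProfiniteTower.toBounded_μ] at h
  rw [show (fun z : ℤ_[p] => (z : ℚ_[p]) ^ 0) = cellInd (𝕜 := ℚ_[p]) 0 (0 : ZMod (p ^ 0)) from
    funext fun z => by rw [pow_zero, cellInd_levelZero]]
  exact h.trans (if_pos rfl)

/-- **`massHom` is surjective**: `c · δ₀` has total mass `c`. [folklore] -/
theorem massHom_surjective {N : ℕ} (hpN : p ∣ N) (v : Fin 1 → ℤ_[p]) : v ∈ LinearMap.range (massHom p N hpN).toLinearMap := by
  refine ⟨v 0 • diracZeroInt, funext fun (i : Fin 1) => Subtype.ext ?_⟩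
  rw [Subsingleton.elim i 0, massHom_apply, coe_massInt]
  have hmem : (diracZeroInt (p := p)).1 ∈ (ProfiniteTower.padicInt p).distributions ℚ_[p] :=
    (((ProfiniteTower.padicInt p).mem_distributionsInt_iff (p := p)).mp (diracZeroInt (p := p)).2).1
  refine (moment_smul hmem (v 0) 0).trans ?_
  rw [moment_zero_diracZero, mul_one]

end Mass

/-! ### The measure-valued eigensymbol of a rational newform and the MTT measure -/

section Main

variable {N : ℕ} [NeZero N] (f : CuspForm (Gamma0 N) 2)

/-- `p · (a/pⁿ⁺¹) = a/pⁿ`. [folklore] -/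
theorem natCast_mul_div_pow_succ (a : ℕ) (n : ℕ) : (p : ℚ) * ((a : ℚ) / (p : ℚ) ^ (n + 1)) = (a : ℚ) / (p : ℚ) ^ n := by
  have hp : (p : ℚ) ≠ 0 := by exact_mod_cast (Fact.out : p.Prime).ne_zero
  rw [pow_succ]
  field_simp

/-- **The Mazur–Tate–Teitelbaum measure is the value at `{0} − {∞}` of a measure-valued ordinary
eigensymbol (weight `2`).**  For a normalised newform `f ∈ S₂(Γ₀(N))` with rational coefficients and
`Ω⁺_f ≠ 0`, `p ∤ N`, and a unit `α ∈ ℤ_p^×` with `α² − a_p(f) α + p = 0`, there are `m ∈ ℕ` and a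
`U_p`-eigensymbol `Ψ ∈ Symb_{Γ₀(Np)}(𝔻⁰_0)` (values: `ℤ_p`-valued measures on `ℤ_p`), `U_p Ψ = α Ψ`,
with `Ψ(0, ∞)(a + pⁿℤ_p) = −p^m · μ_{f,α}(a + pⁿℤ_p)` for all `n, a`.
[cite: GreenbergStevens1993, Thm. 4.10] -/
theorem exists_measureValued_eigensymbol_msdMeasure (hf : IsNewform0 f) (hQ : coeffField f = ⊥) (hΩ : plusPeriod f ≠ 0) (hpN : ¬ p ∣ N)
    {ap : ℚ} (hap : (ap : ℂ) = cuspCoeff f p) (α : ℤ_[p]ˣ) (hα : (α : ℤ_[p]) ^ 2 - (ap : ℚ_[p]) * (α : ℤ_[p]) + p = (0 : ℚ_[p])) :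
    ∃ (m : ℕ) (Ψ : (distCoeffInt p 0 (N * p) (dvd_mul_left p N)).Symb (Gamma0 (N * p))),
      (distCoeffInt p 0 (N * p) (dvd_mul_left p N)).hecke (N * p) p Ψ.1 = (α : ℤ_[p]) • Ψ.1 ∧
      ∀ (n : ℕ) (a : ZMod (p ^ n)), (Ψ.1 (P1Q.ofRat 0) P1Q.infty).1 n a = -((p : ℚ_[p]) ^ m) * msdMeasure f ((α : ℤ_[p]) : ℚ_[p]) n a := by
  haveI : NeZero p := ⟨(Fact.out : p.Prime).ne_zero⟩
  have hpN' : p ∣ N * p := dvd_mul_left p N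
  obtain ⟨m, Φ, hΦmem, hΦeig, hΦval⟩ := exists_intStabSymb f hf hQ hΩ hpN hap α hα
  obtain ⟨Ψ, ⟨hΨeig, hΨπ⟩, -⟩ := existsUnique_measureValued_eigensymbol_of_exact 0 hpN' α
    (CoeffActionOn.symPowOn (sigma0Set (N * p)) 0 ℤ_[p]) (massHom p (N * p) hpN') (massHom_ker hpN') (filGInt_le_ker_massHom hpN')
    ⟨Φ, hΦmem⟩ hΦeig (fun y => massHom_surjective hpN' _)
  refine ⟨m, Ψ, hΨeig, fun n a => ?_⟩
  -- total masses of the values of `Ψ` are the values of `Φ`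
  have hmass : ∀ x y, moment (Ψ.1 x y).1 0 = (Φ x y 0 : ℚ_[p]) := fun x y => by
    have h := congrFun (congrFun (congrFun hΨπ x) y) 0
    rw [CoeffActionOn.Hom.mapFun_apply, massHom_apply] at h
    rw [← coe_massInt, h]
  -- the value formula on the cell `a + pⁿ ℤ_p`
  have hE := integral_cellInd_mul_pow_zero_infty hpN' α hΨeig n a 0
  have hL : (ProfiniteTower.padicInt p).integralFn (Ψ.1 (P1Q.ofRat 0) P1Q.infty).1 (fun z => cellInd (𝕜 := ℚ_[p]) n a z * (z : ℚ_[p]) ^ 0) =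
      (Ψ.1 (P1Q.ofRat 0) P1Q.infty).1 n a := by
    have hint := (ProfiniteTower.toBounded (Ψ.1 (P1Q.ofRat 0) P1Q.infty).2.1).integral_cellInd (𝕜 := ℚ_[p]) n a
    rw [show (fun z : ℤ_[p] => cellInd (𝕜 := ℚ_[p]) n a z * (z : ℚ_[p]) ^ 0) = cellInd (𝕜 := ℚ_[p]) n a from
      funext fun z => by rw [pow_zero, mul_one]]
    exact hint
  rw [hL] at hE
  have hinv : ((((α⁻¹ : ℤ_[p]ˣ) : ℤ_[p]) : ℚ_[p])) = (((α : ℤ_[p]) : ℚ_[p]))⁻¹ := by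
    have hmul : ((α : ℤ_[p]) : ℚ_[p]) * (((α⁻¹ : ℤ_[p]ˣ) : ℤ_[p]) : ℚ_[p]) = 1 := by
      rw [← PadicInt.coe_mul, Units.mul_inv, PadicInt.coe_one]
    exact (inv_eq_of_mul_eq_one_right hmul).symm
  rw [hE, Finset.sum_range_one, hmass, hΦval]
  simp only [Nat.choose_self, Nat.cast_one, Nat.sub_zero, pow_zero, one_mul, mul_one, ratPot_infty, zero_sub, act_deltaMat_infty,
    act_deltaMat_ofRat, ratPot_ofRat, hinv]
  -- compare with `msdMeasure`
  cases n with
  | zero =>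
    have ha : a.val = 0 := by
      have := ZMod.val_lt a
      simp only [pow_zero] at this
      omega
    have h1 : ratPlusSymbol f ((p : ℚ) * (((a.val : ℕ) : ℚ) / (p : ℚ) ^ 0)) = ratPlusSymbol f 0 := by
      rw [ha, Nat.cast_zero, zero_div, mul_zero]
    have h2 : ratPlusSymbol f (((a.val : ℕ) : ℚ) / (p : ℚ) ^ 0) = ratPlusSymbol f 0 := by
      rw [ha, Nat.cast_zero, zero_div]
    rw [msdMeasure, h1, h2]
    push_cast
    ring
  | succ n =>
    rw [msdMeasure, natCast_mul_div_pow_succ a.val n]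
    push_cast
    ring

end Main

end Literature.NumberTheory.EllipticCurves

end
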